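import Literature.AlgebraicGeometry.Motives.AbelianVarietyFrobeniusCharpolyRigidity
import Literature.NumberTheory.LFunctions.WeilPolynomialFromPointCounts
import HarnessLib

/-!
# Weil's theorem for abelian varieties over finite fields: the characteristic polynomial of Frobenius
# on `T_ℓ A` is `∏ (X - α_i)` when `#A(𝔽_{q^r}) = ∏ (1 - α_i^r)` (Mumford §19 Thm. 4, §21; Milne Thm. 19.1)

Let `A` be an abelian variety of dimension `g > 0` over a finite field `K` of characteristic `p`, `π` its
Frobenius endomorphism, and suppose the point counts have the Weil form
`#A(𝔽_{q^r}) = ∏_i (1 - α_i^r)` (`r ≥ 1`, finitely many `α_i`) with `|α_i| = c > 1` (for a Jacobian: `α` = the Frobenius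
eigenvalue multiset of the curve, `c = √q`).  Then (`AbelianVariety.exists_charpoly_frobenius_eq_prod_of_pointCount`)
there is a monic `P ∈ ℤ[X]` of degree `2g` with **`P = ∏_i (X - α_i)` in `ℂ[X]`** and
**`charpoly (π | T_ℓ A) = P` for every prime `ℓ ≠ p`** — i.e. the characteristic polynomial of Frobenius on the
Tate module is the reciprocal of the numerator of the zeta function (Weil 1948; Mumford, *Abelian Varieties*,
§19 Thm. 4 with §21; Milne 1986, Thm. 19.1).

The proof is the tree's RIGIDITY ROUTE, which avoids Mumford §19 Thm. 2 (polynomiality of `deg`, intersection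
theory): `Motives/AbelianVarietyFrobeniusCharpolyRigidity` (the `ℓ`-independent integral `P` with the primary
kernel counts `#S_ℓ(F) = ∏_{P(β)=0} |F(β)|_ℓ⁻¹`, from the theorem of the cube as an upper bound plus `p`-adic
root-multiplicity rigidity) and `LFunctions/WeilPolynomialFromPointCounts` (resultants `Res(P, X^r - 1)`,
`p`-adic separation of roots of unity and the tower argument, exponent windows, and the doubled
`FrobeniusMultiset` counting lemma).  This file only assembles: `#A(𝔽_{q^r}) = #Ker(π^r - 1)(K̄)`
(`pointCount_eq_natCard_kerPoints`), its `ℓ`-primary parts (`natCard_setOf_primary_ker_eq`), and `P(0) ≠ 0`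
(the Frobenius is injective on points).

## References

* [MumfordAV1970] D. Mumford, *Abelian Varieties* (1970), §19 Thm. 4 (p. 180) and §21 (pp. 203–207).
* [Milne1986AbelianVarieties] J. S. Milne, *Abelian Varieties*, in Cornell–Silverman (1986), Thm. 19.1
  (held: `book:cornellnd-arithmetic-geometry`, PDF pp. 212–213).

## Design

Theorems only (D-0014/D-0026).  In the tree (used): `exists_charpoly_frobenius_package`, `isIsogeny_frobeniusHom`,
`isIsogeny_aeval_frobeniusHom`, `finite_kerPoints_of_isFinite`, `natCard_setOf_primary_ker_eq`,
`pointCount_eq_natCard_kerPoints`, `one_sub_frobeniusHom_pow_eq_aeval`, `kerPoints_neg`, `geomPointsMap_aeval`,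
`FrobeniusRigidity.map_eq_prod_X_sub_C_of_pointCounts`.
-/

noncomputable section

open CategoryTheory Polynomial

universe u

namespace Literature.AlgebraicGeometry.Motives

namespace AbelianVariety

open Hom Literature.Algebra.Polynomial.RootRigidity Literature.NumberTheory.LFunctions

variable {K : Type u} [Field K] [Finite K] (A : AbelianVariety K)

/-- **Weil's theorem for abelian varieties (Mumford §19 Thm. 4 with §21; Milne 1986 Thm. 19.1), from Weil-form
point counts.**  If `#A(𝔽_{q^r}) = ∏_i (1 - α_i^r)` for all `r ≥ 1` with `|α_i| = c > 1` (`i ∈ ι` finite), then the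
`ℓ`-independent integral characteristic polynomial `P` of the Frobenius on the Tate modules `T_ℓ A` (`ℓ ≠ p`)
satisfies `P = ∏_i (X - α_i)` over `ℂ` (so `#ι = 2g`). [cite: MumfordAV1970, §19 Thm. 4 and §21; Milne1986AbelianVarieties, Thm. 19.1] -/
theorem exists_charpoly_frobenius_eq_prod_of_pointCount (hA : 0 < A.dim) (p : ℕ) [hp : Fact p.Prime] [CharP K p]
    {c : ℝ} (hc : 1 < c) {ι : Type*} [Fintype ι] {α : ι → ℂ} (hα : ∀ i, ‖α i‖ = c)
    (hpt : ∀ r : ℕ, 0 < r → ((pointCount A.X r : ℕ) : ℂ) = ∏ i, (1 - α i ^ r)) :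
    ∃ P : ℤ[X], P.Monic ∧ P.natDegree = 2 * A.dim ∧ P.map (algebraMap ℤ ℂ) = ∏ i, (Polynomial.X - Polynomial.C (α i)) ∧
      ∀ (ℓ : ℕ) [Fact ℓ.Prime] [Module.Free ℤ_[ℓ] (A.tateModule ℓ)] [Module.Finite ℤ_[ℓ] (A.tateModule ℓ)],
        ℓ ≠ p → (tateModuleMap ℓ (frobeniusHom A)).charpoly = P.map (Int.castRingHom ℤ_[ℓ]) := by
  classical
  obtain ⟨P, hPm, hPdeg, hchar, hkerℓ, Qp, -, hQle, hkerp⟩ := exists_charpoly_frobenius_package A hA p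
  refine ⟨P, hPm, hPdeg, ?_, fun ℓ _ _ _ hℓ => hchar ℓ hℓ⟩
  have hN : 0 < 2 * A.dim := by omega
  -- `F_r(π) = π^r - 1` is an isogeny
  have hiso : ∀ r : ℕ, 0 < r →
      IsIsogeny ((aeval (End.of (frobeniusHom A)) (Polynomial.X ^ r - 1 : ℤ[X]) : End A) : A ⟶ A) := by
    intro r hr
    refine isIsogeny_aeval_frobeniusHom (A := A) (Polynomial.X ^ r - 1 : ℤ[X]) ?_
    rw [coeff_sub, coeff_X_pow, if_neg (Nat.pos_iff_ne_zero.mp hr).symm, coeff_one_zero, zero_sub,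
      Int.cast_neg, Int.cast_one, neg_ne_zero]
    exact one_ne_zero
  -- `#Ker (π^r - 1)(K̄) = #A(𝔽_{q^r})`
  have hcount : ∀ r : ℕ, 0 < r →
      Nat.card (kerPoints (specOver K (AlgebraicClosure K))
        ((aeval (End.of (frobeniusHom A)) (Polynomial.X ^ r - 1 : ℤ[X]) : End A) : A ⟶ A)) = pointCount A.X r := by
    intro r hr
    rw [pointCount_eq_natCard_kerPoints, one_sub_frobeniusHom_pow_eq_aeval]
    have e : (aeval (End.of (frobeniusHom A)) (1 - Polynomial.X ^ r : ℤ[X]) : End A) =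
        -(aeval (End.of (frobeniusHom A)) (Polynomial.X ^ r - 1 : ℤ[X]) : End A) := by
      rw [← map_neg, neg_sub]
    rw [e, kerPoints_neg]
  -- the primary parts of `#A(𝔽_{q^r})`
  have hprim : ∀ (ℓ : ℕ) [Fact ℓ.Prime] (r : ℕ), 0 < r →
      (Nat.card {a : A.geomPoints | (∃ n : ℕ, ℓ ^ n • a = 0) ∧
        (aeval (A := AddMonoid.End A.geomPoints) (geomPointsMap (frobeniusHom A)) (Polynomial.X ^ r - 1 : ℤ[X])) a = 0} : ℝ) =
        (ℓ : ℝ) ^ ((pointCount A.X r).factorization ℓ) := by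
    intro ℓ _ r hr
    have hu := hiso r hr
    haveI := hu.2
    haveI : Finite (kerPoints (specOver K (AlgebraicClosure K))
        ((aeval (End.of (frobeniusHom A)) (Polynomial.X ^ r - 1 : ℤ[X]) : End A) : A ⟶ A)) :=
      finite_kerPoints_of_isFinite _ (AlgebraicClosure K)
    rw [← hcount r hr, ← Nat.cast_pow, ← natCard_setOf_primary_ker_eq _ ℓ, geomPointsMap_aeval]
    rfl
  -- the hypotheses of the number-theoretic core
  have hℓ' : ∀ (ℓ : ℕ) [Fact ℓ.Prime], ℓ ≠ p → ∀ r : ℕ, 0 < r →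
      ((ℓ : ℝ) ^ ((pointCount A.X r).factorization ℓ)) = kerNorm (P.map (Int.castRingHom ℤ_[ℓ])) (Polynomial.X ^ r - 1) := by
    intro ℓ _ hℓ r hr
    rw [← hprim ℓ r hr]
    exact (hkerℓ ℓ hℓ (Polynomial.X ^ r - 1) (hiso r hr)).2
  have hpv' : ∀ r : ℕ, 0 < r → ((p : ℝ) ^ ((pointCount A.X r).factorization p)) = kerNorm Qp (Polynomial.X ^ r - 1) := by
    intro r hr
    rw [← hprim p r hr]
    exact (hkerp (Polynomial.X ^ r - 1) (hiso r hr)).2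
  -- `P(0) ≠ 0`: the Frobenius kills no non-zero point, so `∏ |β|_ℓ⁻¹ = #S_ℓ(X) = 1 ≠ 0`
  have hP0 : P.coeff 0 ≠ 0 := by
    obtain ⟨ℓ, hℓp, hℓprime⟩ := Nat.exists_infinite_primes (p + 1)
    haveI : Fact ℓ.Prime := ⟨hℓprime⟩
    have hne : ℓ ≠ p := by omega
    have hisoX : IsIsogeny ((aeval (End.of (frobeniusHom A)) (Polynomial.X : ℤ[X]) : End A) : A ⟶ A) := by
      rw [aeval_X]
      exact isIsogeny_frobeniusHom A
    obtain ⟨hfin, hcard⟩ := hkerℓ ℓ hne Polynomial.X hisoX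
    intro h0
    have hroot : (0 : PadicAlgCl ℓ) ∈
        ((P.map (Int.castRingHom ℤ_[ℓ])).map (algebraMap ℤ_[ℓ] (PadicAlgCl ℓ))).roots := by
      rw [mem_roots ((hPm.map _).map _).ne_zero, IsRoot.def, eval_zero_map, eval_zero_map,
        ← coeff_zero_eq_eval_zero, h0, map_zero, map_zero]
    have hker0 : kerNorm (P.map (Int.castRingHom ℤ_[ℓ])) Polynomial.X = 0 :=
      Multiset.prod_eq_zero (Multiset.mem_map.mpr ⟨0, hroot, by rw [aeval_X, norm_zero, inv_zero]⟩)
    rw [hker0] at hcard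
    haveI := hfin.to_subtype
    haveI : Nonempty {a : A.geomPoints | (∃ n : ℕ, ℓ ^ n • a = 0) ∧
        (aeval (A := AddMonoid.End A.geomPoints) (geomPointsMap (frobeniusHom A)) (Polynomial.X : ℤ[X])) a = 0} :=
      ⟨⟨0, ⟨0, smul_zero _⟩, map_zero _⟩⟩
    have hpos : 0 < Nat.card {a : A.geomPoints | (∃ n : ℕ, ℓ ^ n • a = 0) ∧
        (aeval (A := AddMonoid.End A.geomPoints) (geomPointsMap (frobeniusHom A)) (Polynomial.X : ℤ[X])) a = 0} :=
      Nat.card_pos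
    have h0' : Nat.card {a : A.geomPoints | (∃ n : ℕ, ℓ ^ n • a = 0) ∧
        (aeval (A := AddMonoid.End A.geomPoints) (geomPointsMap (frobeniusHom A)) (Polynomial.X : ℤ[X])) a = 0} = 0 := by
      exact_mod_cast hcard
    omega
  exact FrobeniusRigidity.map_eq_prod_X_sub_C_of_pointCounts p hPm hPdeg hN hP0 hc hα hpt hℓ' hQle hpv'

end AbelianVariety

end Literature.AlgebraicGeometry.Motives

end
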